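import Literature.NumberTheory.LFunctions.WeilFirstPrimeCertificateDataC
import HarnessLib

/-!
# First-prime Weil positivity, stage C: kernel check of the even scaled moments ν_84, ν_86, ν_88, ν_90, ν_92, ν_94

Part of `weilCert3C.check` (`WeilFirstPrimeCertificateDataC.lean`), evaluated by `decide +kernel` and kept in its own
file for kernel time and memory (each declaration is checked separately). Assembled in
`WeilFirstPrimeCertificateCCheck.lean`. Pure proof file; nothing is asserted.
-/

noncomputable section

namespace Literature.NumberTheory.LFunctions

set_option maxHeartbeats 0 in
/-- **Kernel check of the scaled moment `ν_{84}`** of the stage-C first-prime certificate. [folklore] -/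
theorem checkNuAt84_weilCert3C : weilCert3C.checkNuAt 84 = true := by
  decide +kernel

set_option maxHeartbeats 0 in
/-- **Kernel check of the scaled moment `ν_{86}`** of the stage-C first-prime certificate. [folklore] -/
theorem checkNuAt86_weilCert3C : weilCert3C.checkNuAt 86 = true := by
  decide +kernel

set_option maxHeartbeats 0 in
/-- **Kernel check of the scaled moment `ν_{88}`** of the stage-C first-prime certificate. [folklore] -/
theorem checkNuAt88_weilCert3C : weilCert3C.checkNuAt 88 = true := by
  decide +kernel

set_option maxHeartbeats 0 in
/-- **Kernel check of the scaled moment `ν_{90}`** of the stage-C first-prime certificate. [folklore] -/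
theorem checkNuAt90_weilCert3C : weilCert3C.checkNuAt 90 = true := by
  decide +kernel

set_option maxHeartbeats 0 in
/-- **Kernel check of the scaled moment `ν_{92}`** of the stage-C first-prime certificate. [folklore] -/
theorem checkNuAt92_weilCert3C : weilCert3C.checkNuAt 92 = true := by
  decide +kernel

set_option maxHeartbeats 0 in
/-- **Kernel check of the scaled moment `ν_{94}`** of the stage-C first-prime certificate. [folklore] -/
theorem checkNuAt94_weilCert3C : weilCert3C.checkNuAt 94 = true := by
  decide +kernel

end Literature.NumberTheory.LFunctions
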